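import Summits.Ventures.HodgeRepro2.T6A2WeilSurface
import Summits.Ventures.HodgeRepro2.T6A2WeilCoproduct
import Summits.Ventures.HodgeRepro2.T6InterfaceOfData

/-!
# T6A2WeilKappa — the Künneth map `κ : HBB K → H^*(B × B, ℚ)` and the identification of `∫_{B×B}`

Cell pub-hodge-repro2, Tier 6 (README §10), seat t6-p2 (A2 host side). The model's graded tensor square
`HBB K = HB K ᵍ⊗ HB K` maps to the host's cohomology of `B × B` by `κ := GradedTensorProduct.lift` of the two
legs `a ↦ pr₁^* (evF⁻¹ a)`, `b ↦ pr₂^* (evF⁻¹ b)` (anti-commuting by the Koszul sign of the full ring,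
`ofDegF_mul_ofDegF_comm`, from `W.cup_comm`). NO bijectivity of `κ` is used anywhere in the A2 glue on the
host: what the Pontryagin-product field needs is
* `κ_cop`: `κ ∘ m^*_{model} = m^* ∘ evF⁻¹` (the shuffle coproduct `Toy.cop K` of the model is the host's
  `m^*`, from the group law — T6A2WeilCoproduct), and
* **`intBBOf_eq_integralF_κ`**: the lead's Künneth functional `OfData.intBBOf K intB` (`a ᵍ⊗ b ↦ ∫_B a · ∫_B b`)
  is `∫_{B×B} ∘ κ` — on homogeneous tensors both sides vanish unless both degrees are `2 dim B`, where the
  host's `trace_externalCup` gives the product of the traces.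
No `sorry`; standard axioms. §8(d): uses an L-value-free non-vanishing device: NO.
-/

noncomputable section

namespace Summit.Ventures.HodgeRepro2.T6.WeilInst

open HostAPI.Carriers.AlgebraicGeometry.Motives CategoryTheory Opposite MonoidalCategory
  CartesianMonoidalCategory
open Summit.Ventures.HodgeRepro2.T6 Summit.Ventures.HodgeRepro2.T6.A2Gysin
  Summit.Ventures.HodgeRepro2.T6.A2Shadow
open scoped DirectSum TensorProduct

universe u

variable {k : Type u} [Field k] (W : WeilCohomology k ℚ)

section koszul

variable (P : SPVar k)

/-- THE KOSZUL SIGN OF THE FULL RING: `ofDegF i x * ofDegF j y = (−1)^{j i} • (ofDegF j y * ofDegF i x)`. -/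
theorem ofDegF_mul_ofDegF_comm {i j : ℕ} (x : W.obj P.X i) (y : W.obj P.X j) :
    ofDegF W P i x * ofDegF W P j y = ((-1 : ℤˣ) ^ (j * i)) • (ofDegF W P j y * ofDegF W P i x) := by
  rw [ofDegF_mul_ofDegF, ofDegF_mul_ofDegF, W.cup_comm P.smooth rfl (by omega : j + i = i + j) x y,
    map_zsmul, ← ofDegF_castDeg W P (by omega : j + i = i + j) (W.cup rfl y x), castDeg_cup,
    Units.smul_def]
  congr 1
  show (((i : ℤ) * (j : ℤ)).negOnePow : ℤ) = (((-1 : ℤˣ) ^ (j * i) : ℤˣ) : ℤ)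
  rw [← Nat.cast_mul, Int.coe_negOnePow_natCast, mul_comm j i]
  rfl

end koszul

section kappa

variable {K : Type*} [Field K] [NumberField K] (D : SituationData k) (A : OrderAction W D.B K)
  (hL : Function.Bijective (langeMap W D.B))

/-- the left leg of the Künneth map: `a ↦ pr₁^* (evF⁻¹ a)` -/
def legL : HB K →ₐ[ℚ] FullRing W D.BB :=
  (pullF W (P := D.BB) (Q := D.B) (fst D.B.X D.B.X)).comp (evF W D A hL).symm.toAlgHom

/-- the right leg of the Künneth map: `b ↦ pr₂^* (evF⁻¹ b)` -/
def legR : HB K →ₐ[ℚ] FullRing W D.BB :=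
  (pullF W (P := D.BB) (Q := D.B) (snd D.B.X D.B.X)).comp (evF W D A hL).symm.toAlgHom

/-- `legL`, unfolded -/
theorem legL_apply (a : HB K) :
    legL W D A hL a = pullF W (P := D.BB) (Q := D.B) (fst D.B.X D.B.X) ((evF W D A hL).symm a) := rfl

/-- `legR`, unfolded -/
theorem legR_apply (b : HB K) :
    legR W D A hL b = pullF W (P := D.BB) (Q := D.B) (snd D.B.X D.B.X) ((evF W D A hL).symm b) := rfl

/-- a leg of a homogeneous class is homogeneous of the same degree -/
theorem legL_mem {i : ℕ} {a : HB K} (ha : a ∈ degB K i) :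
    ∃ x : W.obj D.B.X i, legL W D A hL a = ofDegF W D.BB i (W.pullback (fst D.B.X D.B.X) i x) := by
  obtain ⟨x, hx⟩ := evF_symm_mem_range_ofDegF W D A hL ha
  exact ⟨x, by rw [legL_apply, ← hx]; exact pullF_ofDegF W _ i x⟩

/-- a leg of a homogeneous class is homogeneous of the same degree -/
theorem legR_mem {j : ℕ} {b : HB K} (hb : b ∈ degB K j) :
    ∃ y : W.obj D.B.X j, legR W D A hL b = ofDegF W D.BB j (W.pullback (snd D.B.X D.B.X) j y) := by
  obtain ⟨y, hy⟩ := evF_symm_mem_range_ofDegF W D A hL hb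
  exact ⟨y, by rw [legR_apply, ← hy]; exact pullF_ofDegF W _ j y⟩

/-- the two legs anti-commute with the Koszul sign -/
theorem leg_anti : ∀ ⦃i j : ℕ⦄ (a : degB K i) (b : degB K j),
    legL W D A hL a * legR W D A hL b = ((-1 : ℤˣ) ^ (j * i)) • (legR W D A hL b * legL W D A hL a) := by
  intro i j a b
  obtain ⟨x, hx⟩ := legL_mem W D A hL a.2
  obtain ⟨y, hy⟩ := legR_mem W D A hL b.2
  rw [hx, hy]
  exact ofDegF_mul_ofDegF_comm W D.BB _ _

/-- THE KÜNNETH MAP OF THE MODEL INTO THE HOST: `a ᵍ⊗ b ↦ pr₁^*(evF⁻¹ a) · pr₂^*(evF⁻¹ b)`. -/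
def κ : HBB K →ₐ[ℚ] FullRing W D.BB :=
  GradedTensorProduct.lift (fun i : ℕ => ⋀[ℚ]^i (H1 K)) (fun i : ℕ => ⋀[ℚ]^i (H1 K))
    (legL W D A hL) (legR W D A hL) (leg_anti W D A hL)

/-- `κ` on a graded tensor -/
theorem κ_tmul (a b : HB K) : κ W D A hL (a ᵍ⊗ₜ b) = legL W D A hL a * legR W D A hL b :=
  GradedTensorProduct.lift_tmul _ _ _ _ _ a b

/-- `κ ∘ pr₁^* = legL` -/
theorem κ_inl (a : HB K) : κ W D A hL (inl K a) = legL W D A hL a := by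
  rw [Parity.inl_apply, κ_tmul, map_one, mul_one]

/-- `κ ∘ pr₂^* = legR` -/
theorem κ_inr (b : HB K) : κ W D A hL (inr K b) = legR W D A hL b := by
  rw [Parity.inr_apply, κ_tmul, map_one, one_mul]

/-- THE SHUFFLE COPRODUCT OF THE MODEL IS THE HOST'S `m^*`: `κ (Toy.cop u) = m^* (evF⁻¹ u)`
(the group law: T6A2WeilCoproduct). -/
theorem κ_cop (G : GroupLaw D) (hpt : IsSmoothProjective 0 (𝟙_ (SchemeOver k))) (u : HB K) :
    κ W D A hL (Toy.cop K u) = pullF W (P := D.BB) (Q := D.B) D.m ((evF W D A hL).symm u) := by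
  have h : (κ W D A hL).comp (Toy.cop K) =
      (pullF W (P := D.BB) (Q := D.B) D.m).comp (evF W D A hL).symm.toAlgHom := by
    apply ExteriorAlgebra.hom_ext
    refine LinearMap.ext fun v => ?_
    simp only [LinearMap.comp_apply, AlgHom.toLinearMap_apply, AlgHom.comp_apply, AlgEquiv.coe_toAlgHom]
    rw [Toy.cop_ι, map_add, κ_inl, κ_inr, legL_apply, legR_apply, evF_symm_apply,
      ExteriorAlgebra.map_apply_ι, langeMap_ι, pullF_m_ι₁ W D G hpt]
  exact congrArg (fun g => g u) h

end kappa

section integral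

variable {K : Type*} [Field K] [NumberField K] (D : SituationData k) (A : OrderAction W D.B K)
  (hL : Function.Bijective (langeMap W D.B))

/-- `∫_B` on the model: `integral ∘ ψ` (the `intB` of the A2 shadow on the host) -/
def intBW : HB K →ₗ[ℚ] ℚ := (integral W D.B) ∘ₗ psiOf W D A hL

/-- `∫_B` of a homogeneous class: the trace in the top degree, `0` elsewhere -/
theorem intBW_of_mem {i : ℕ} {a : HB K} (ha : a ∈ degB K i) {x : W.obj D.B.X i}
    (hx : ofDegF W D.B i x = (evF W D A hL).symm a) :
    intBW W D A hL a = if h : i = 2 * D.B.n then W.trace D.B.X D.B.n (castDeg W h x) else 0 := by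
  rw [intBW, LinearMap.comp_apply, psiOf_apply, ← hx]
  split_ifs with h
  · subst h
    rw [fullToEven_ofDegF_even, integral_ofDeg_top, castDeg_rfl]
  · obtain ⟨i', hi | hi⟩ := Nat.even_or_odd' i
    · subst hi
      rw [fullToEven_ofDegF_even, integral_ofDeg_of_ne W D.B (by omega)]
    · subst hi
      rw [fullToEven_ofDegF_odd, map_zero]

/-- THE IDENTIFICATION OF `∫_{B×B}`, on homogeneous classes: `∫_B a · ∫_B b = ∫_{B×B} (legL a · legR b)`. -/
theorem intBW_mul_intBW_of_mem {i j : ℕ} {a b : HB K} (ha : a ∈ degB K i) (hb : b ∈ degB K j) :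
    intBW W D A hL a * intBW W D A hL b = integralF W D.BB (legL W D A hL a * legR W D A hL b) := by
  obtain ⟨x, hx⟩ := evF_symm_mem_range_ofDegF W D A hL ha
  obtain ⟨y, hy⟩ := evF_symm_mem_range_ofDegF W D A hL hb
  rw [intBW_of_mem W D A hL ha hx, intBW_of_mem W D A hL hb hy, legL_apply, legR_apply, ← hx, ← hy,
    pullF_ofDegF, pullF_ofDegF, ofDegF_mul_ofDegF]
  have hBB : D.BB.n = D.B.n + D.B.n := rfl
  by_cases hi : i = 2 * D.B.n
  · subst hi
    by_cases hj : j = 2 * D.B.n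
    · subst hj
      rw [dif_pos rfl, dif_pos rfl, castDeg_rfl, castDeg_rfl,
        ← ofDegF_castDeg W D.BB (by omega : 2 * D.B.n + 2 * D.B.n = 2 * D.BB.n), castDeg_cup,
        integralF_ofDegF_top, ← W.trace_externalCup D.B.smooth D.B.smooth x y]
      rfl
    · rw [dif_neg hj, mul_zero, integralF_ofDegF_of_ne W D.BB (by omega)]
  · rw [dif_neg hi, zero_mul]
    by_cases hij : i + j = 2 * D.BB.n
    · -- one of the two degrees exceeds `2 dim B`: that class vanishes
      rcases Nat.lt_or_gt_of_ne hi with hlt | hgt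
      · have hj : 2 * D.B.n < j := by omega
        haveI := W.subsingleton_obj D.B.smooth hj
        rw [Subsingleton.elim y 0]
        simp
      · haveI := W.subsingleton_obj D.B.smooth hgt
        rw [Subsingleton.elim x 0]
        simp
    · rw [integralF_ofDegF_of_ne W D.BB hij]

/-- **THE LEAD'S KÜNNETH FUNCTIONAL IS THE HOST'S `∫_{B×B}` THROUGH `κ`**:
`OfData.intBBOf K intB w = ∫_{B×B} (κ w)` for every `w ∈ HBB K`. -/
theorem intBBOf_eq_integralF_κ (w : HBB K) :
    OfData.intBBOf K (intBW W D A hL) w = integralF W D.BB (κ W D A hL w) := by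
  -- both sides are linear in `w`; compare on the tensors `a ᵍ⊗ b`, then on homogeneous `a`, `b`
  let Φ : HB K →ₗ[ℚ] HB K →ₗ[ℚ] ℚ := (LinearMap.mul ℚ ℚ).compl₁₂ (intBW W D A hL) (intBW W D A hL)
  let Ψ : HB K →ₗ[ℚ] HB K →ₗ[ℚ] ℚ :=
    ((LinearMap.mul ℚ (FullRing W D.BB)).compl₁₂ (legL W D A hL).toLinearMap
      (legR W D A hL).toLinearMap).compr₂ (integralF W D.BB)
  have hΦΨ : Φ = Ψ := by
    refine ext_of_forall_degB K fun i a ha => ?_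
    refine ext_of_forall_degB K fun j b hb => ?_
    simp only [Φ, Ψ, LinearMap.compl₁₂_apply, LinearMap.compr₂_apply, LinearMap.mul_apply',
      AlgHom.toLinearMap_apply]
    exact intBW_mul_intBW_of_mem W D A hL ha hb
  have hlin : OfData.intBBOf K (intBW W D A hL) = (integralF W D.BB) ∘ₗ (κ W D A hL).toLinearMap := by
    refine GradedTensorProduct.hom_ext (fun i : ℕ => ⋀[ℚ]^i (H1 K)) (fun i : ℕ => ⋀[ℚ]^i (H1 K)) ?_
    refine TensorProduct.ext' fun a b => ?_
    have h1 : OfData.intBBOf K (intBW W D A hL) (a ᵍ⊗ₜ b) = Φ a b := OfData.intBBOf_tmul' _ a b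
    have h2 : integralF W D.BB (κ W D A hL (a ᵍ⊗ₜ b)) = Ψ a b := by
      rw [κ_tmul]
      rfl
    change OfData.intBBOf K (intBW W D A hL) (a ᵍ⊗ₜ b) = integralF W D.BB (κ W D A hL (a ᵍ⊗ₜ b))
    rw [h1, h2, hΦΨ]
  exact congrArg (fun g => g w) hlin

end integral

end Summit.Ventures.HodgeRepro2.T6.WeilInst

end
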